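import Literature.IUT.LogVolume.FakeAdeleIndex
import Literature.IUT.LogVolume.PilotDivisors
import Mathlib.Tactic.FieldSimp
import Mathlib.Tactic.Ring
import HarnessLib

/-!
# The space `𝕃`, its Mochizuki log-measure, the regions `O_𝕃(−D)`, and the degree/volume conversion
# theorem (Dupuy–Hilado, *The statement of Mochizuki's Corollary 3.12*, Def. 3.5.1, Ex. 3.5.3,
# Def. 3.6.1, Def. 3.6.3, §3.7–§3.9, Thm. 3.10.1)

Dupuy–Hilado, arXiv:2004.13228 (pre-split text; Ramanujan J. **68** (2025)), read on the page
(corpus render `paper:arxiv-2004.13228`, chunks 8–12). The printed definitions this file types: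

* Def. 3.5.1: "A random measure space over `S` is a tuple `X = (X_s)_{s∈S}` where for each `s ∈ S`,
  `X_s = (X_s, μ_{X_s})` is a measure space. A random measurable set is a set `U = (U_s)_{s∈S} ∈
  Π_{s∈S} M(X_s)`. … The expected normalized log measure of a random measurable set is
  `ln ν̄(U) = 𝔼(log μ̄(U_s) : s ∈ S)`." (Rmk. 3.5.2: "we will conflate `(U_s)_{s∈S} ∈ N(X)` with
  `Π_{s∈S} U_s ⊂ X` when convenient.")
* Def. 3.6.1 / §3.6: "`𝔸^{⊗ r+1}_{V̲,p} = ⊕_{(v_0,…,v_r) ∈ V(F₀)^{r+1}} K_{v̲_0} ⊗ ⋯ ⊗ K_{v̲_r}` … Here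
  the tensor products are taken over `ℚ_p`"; "`log μ̄_{(v̲_0,…,v̲_r)}` … the unique normalized log Haar
  measure on the tensor product of fields `K_{v̲_0} ⊗ ⋯ ⊗ K_{v̲_r}` satisfying
  `log μ̄_{v⃗}(O_{v⃗}) = 0`"; "`ln ν̄_{𝔸^{⊗ r+1}_{V̲,p}}(U) = 𝔼(log μ̄_{v⃗}(U_{v⃗}) : v⃗ ∈ V(F₀)^{r+1})`".
* Def. 3.6.3: "`𝕃 = Π_p 𝕃_p`, `ln ν̄_𝕃(B) = Σ_p ln ν̄_{𝕃_p}(B_p)`; `𝕃_p = ⊕_{j=1}^{(l−1)/2} 𝔸^{⊗ j+1}_{V̲,p}`,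
  `ln ν̄_{𝕃_p}(B) = 𝔼(ln ν̄_{𝔸^{⊗ j+1}_{V̲,p}}(B_p^{(j+1)}) | 1 ≤ j ≤ (l−1)/2)`".
* §3.7 (action through a tensor factor): "`log μ̄_{(v̲_0,…,v̲_{r−1})}(a_{v̲_{r−1}}·U) = ln|a_{v̲_{r−1}}|_p
  + log μ̄(U)`, where the action of `a_{v̲_{r−1}}` on `K_{v̲_0} ⊗ ⋯ ⊗ K_{v̲_{r−1}}` is through the `r`th
  tensor factor" — with `|x|_p = p^{−ord_p(x)}` (§2.4.6), so `ln|a|_p = −ord_v(a)·ln|κ(v)|/[F_{0,v}:ℚ_p]`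
  (§3.4 "`log μ̄_{F_{0,v}}(a_v O_v) = ln|a_v|_p = −deĝ(ord_v(a_v)[v])/[F_{0,v}:ℚ_p]`").
* §3.9: "Let `D ∈ Div̂(F₀)_{0,ℚ}` and let `a = (a_{v̲}) ∈ 𝔸_{V̲}` be such that `D = div(a)`. Fix some index
  `i` … `O_{𝕃^{(r)}_p}(−D) = ⊕_{v⃗ ∈ V(F₀)_p^{r+1}} peel^i_{v̲}((a_{v̲})) · O_{Peel^i_{v̲} 𝕃^{(r)}_p}`. …
  If `D = (D_j) ∈ Div(F₀)_{0,lgp}` then `O_𝕃(−D) := ⊕_{j=1}^r O_{𝕃^{(j)}}(−D_j)`."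
* Thm. 3.10.1: "(Conversion for Fake Adeles) If `D ∈ Div̂(F₀)_{ℤ[1/d]}` then for every `r ≥ 1` we have
  `−deĝ̲_{F₀}(D) = ln ν̄_{𝔸_{V̲}}(O_{𝔸_{V̲}}(−D)) = ln ν̄_{𝕃^{(r−1)}}(O_{𝕃^{(r−1)}}(−D))`. (Conversion for
  lgp Divisors) If `D = (D_j) ∈ Div̂(F₀)_{lgp,ℤ[1/d]}` then `−deĝ̲_{lgp,F₀}(D) = ln ν̄_𝕃(O_𝕃(−D))`."

DESIGN (top-down, statements-first). The summand carriers `K_{v̲_0} ⊗_{ℚ_p} ⋯ ⊗ K_{v̲_j}`, their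
integral structures, normalised log Haar measures and the peel action are an INTERFACE
(`PacketModel`): a structure whose fields are exactly the printed properties used by the conversion
theorem — monotone normalised log-measure on admissible sets, `log μ̄_{v⃗}(O_{v⃗}) = 0`, and the
action-through-a-tensor-factor formula (3.7) with `ln|a|_p` in the form (3.4). CONSTRUCTING a model
(tensor products of `p`-adic fields with Haar measure, [IUTchIV] Prop. 1.1–1.4) is the business of
the measure-theoretic files of this directory (cell seats abc-iut-S1/S2); when such a model lands, it
instantiates `PacketModel` and every theorem here applies to it. What is DEFINED here over the
interface: random measurable sets of `𝕃` (componentwise), `ln ν̄_{𝔸^{⊗ j+1}_{V,p}}`, `ln ν̄_{𝕃_p}`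
(iterated expectations over the probability spaces of `FakeAdeleIndex`), `ln ν̄_𝕃` over a finite set
of primes, and the regions `O_𝕃(−div(t))` of an "lgp-idele" `t`. What is PROVED: Thm. 3.10.1 (ii)
(tensor-power case, per prime and per `j`: `lnν_tensorPower_region`) and (iii)
(`lnν_L_region_eq_neg_ndegLgp`): the log-volume of `O_𝕃(−div(t))` is minus the normalised lgp-degree
of `div(t)` — by the two averaging identities of `FakeAdeleIndex` ("this is exactly the reason we
defined `ln ν̄` in this "fake adelic" way"). Normalisation: we use the NORMALISED degree `deĝ̲`
throughout (Thm. 3.10.1 prints `deĝ̲`; (1.1) prints it as `deĝ̲` too).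

Deliberately NOT here: the indeterminacies (Ind1), (Ind2), (Ind3), `U_Θ` and hulls (§4; see the cell's
`Summits/ABC/IUTFork/` files), archimedean factors (`p = ∞`), the four interpretations of `𝕃` (p. 3),
any disputed statement. `TODO(general form)`: `ln ν̄_𝕃` as a sum over ALL `p` (we sum over a finite
set of primes containing the support, which is what every region `O_𝕃(−D)` needs since
`log μ̄_{v⃗}(O_{v⃗}) = 0` off the support of `D`).
-/

noncomputable section

namespace Literature.IUT.LogVolume

open NumberField IsDedekindDomain Finset

variable (F : Type*) [Field F] [NumberField F]

/-! ## The interface: summands of `𝕃`, their log-measures, integral structures, peel actions -/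

/-- **Packet model** (INTERFACE for Dupuy–Hilado Def. 3.5.1/3.6.1/3.6.3, §3.7–§3.9). For every rational
prime `p`, every `j ≥ 0` and every tuple `v⃗ = (v_0,…,v_j) ∈ V(F)_p^{j+1}`: the summand `X_{v⃗}`
(standing for `K_{v̲_0} ⊗_{ℚ_p} ⋯ ⊗ K_{v̲_j}`), its admissible (measurable, positive finite measure)
subsets, the normalised log-measure `log μ̄_{v⃗}` (monotone), the integral structure `O_{v⃗}` with
`log μ̄_{v⃗}(O_{v⃗}) = 0` ("Haar measures on tensor products are normalized so that `μ_L(O_L) = 1`",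
§2.4.5/(3.6)); for every place `v ∈ V(F)_p` a type `Λ_v` of local scalars (standing for `K_{v̲}^×`,
§3.7 "`a_{v̲_{r−1}} ∈ K_{v̲_{r−1}}`") with their valuation `ord_v : Λ_v → ℝ` (normalised to `F_v`,
rational-valued on `K_{v̲}`), and the PEEL ACTION of `Λ_{v_j}` on `X_{v⃗}` through the LAST tensor
factor (§3.8; Thm. 3.10.1 proof: "without loss of generality … defined via the `r`th peel map")
satisfying (3.7) with (3.4): `log μ̄_{v⃗}(a·U) = ln|a|_p + log μ̄_{v⃗}(U)`,
`ln|a|_p = −ord_v(a)·ln|κ(v)|/n_v`. Fields quote print; nothing here is a claim.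
[cite: DupuyHilado2025, Def. 3.5.1, Def. 3.6.1, §3.7–3.9] -/
structure PacketModel where
  /-- the summand `X_{v⃗} = K_{v̲_0} ⊗ ⋯ ⊗ K_{v̲_j}` of `𝔸^{⊗ j+1}_{V̲,p}` indexed by `v⃗ ∈ V(F)_p^{j+1}` -/
  X : (p : ℕ) → (j : ℕ) → (Fin (j + 1) → placesOver F p) → Type
  /-- admissible subsets of `X_{v⃗}` (measurable, of positive finite measure): `M(X_{v⃗})` -/
  adm : {p : ℕ} → {j : ℕ} → {e : Fin (j + 1) → placesOver F p} → Set (X p j e) → Prop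
  /-- the normalised log-measure `log μ̄_{v⃗} = log μ_{v⃗}/dim_{ℚ_p}` (§3.4), used on admissible sets -/
  logμ : {p : ℕ} → {j : ℕ} → {e : Fin (j + 1) → placesOver F p} → Set (X p j e) → ℝ
  /-- `log μ̄_{v⃗}` is monotone on admissible sets -/
  logμ_mono : ∀ {p : ℕ} {j : ℕ} {e : Fin (j + 1) → placesOver F p} {A B : Set (X p j e)},
    adm A → adm B → A ⊆ B → logμ A ≤ logμ B
  /-- the integral structure `O_{v⃗} ⊂ X_{v⃗}` (§2.4.5, §3.6) -/
  O : (p : ℕ) → (j : ℕ) → (e : Fin (j + 1) → placesOver F p) → Set (X p j e)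
  /-- `O_{v⃗}` is admissible -/
  O_adm : ∀ (p : ℕ) (j : ℕ) (e : Fin (j + 1) → placesOver F p), adm (O p j e)
  /-- NORMALISATION `log μ̄_{v⃗}(O_{v⃗}) = 0` (3.6) -/
  logμ_O : ∀ (p : ℕ) (j : ℕ) (e : Fin (j + 1) → placesOver F p), logμ (O p j e) = 0
  /-- local scalars `Λ_v` at the place `v | p` (`K_{v̲}^×`) -/
  Λ : (p : ℕ) → placesOver F p → Type
  /-- their valuation `ord_v : Λ_v → ℝ`, normalised to `F_v` (`ord_L = e(L/K) ord_K`, §2.4.2) -/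
  ordv : {p : ℕ} → {v : placesOver F p} → Λ p v → ℝ
  /-- the peel action of `a ∈ Λ_{v_j}` on `X_{(v_0,…,v_j)}` through the last tensor factor (§3.8) -/
  peel : {p : ℕ} → {j : ℕ} → {e : Fin (j + 1) → placesOver F p} →
    Λ p (e (Fin.last j)) → X p j e → X p j e
  /-- (3.7) admissibility is preserved by the action -/
  peel_adm : ∀ {p : ℕ} {j : ℕ} {e : Fin (j + 1) → placesOver F p} (a : Λ p (e (Fin.last j)))
    {U : Set (X p j e)}, adm U → adm (peel a '' U)
  /-- **(3.7) with (3.4)**: `log μ̄_{v⃗}(a·U) = −ord_v(a)·ln|κ(v)|/n_v + log μ̄_{v⃗}(U)`, `v = v_j` -/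
  logμ_peel : ∀ {p : ℕ} {j : ℕ} {e : Fin (j + 1) → placesOver F p} (a : Λ p (e (Fin.last j)))
    {U : Set (X p j e)}, adm U →
      logμ (peel a '' U) =
        -(ordv a) * logNorm F (e (Fin.last j)).1 / localDegree F (e (Fin.last j)).1 + logμ U

namespace PacketModel

variable {F} (M : PacketModel F)

/-- `ln|a|_p := −ord_v(a)·ln|κ(v)|/n_v` for a local scalar `a ∈ Λ_v` — (3.4) "`ln|a_v|_p =
−deĝ(ord_v(a_v)[v])/[F_{0,v}:ℚ_p]`". [cite: DupuyHilado2025, §3.4] -/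
def lnAbs {p : ℕ} {v : placesOver F p} (a : M.Λ p v) : ℝ :=
  -(M.ordv a * logNorm F v.1) / localDegree F v.1

/-- (3.7) restated with `ln|a|_p`: `log μ̄_{v⃗}(a·U) = ln|a|_p + log μ̄_{v⃗}(U)`.
[cite: DupuyHilado2025, §3.7] -/
theorem logμ_peel_eq {p j : ℕ} {e : Fin (j + 1) → placesOver F p} (a : M.Λ p (e (Fin.last j)))
    {U : Set (M.X p j e)} (hU : M.adm U) :
    M.logμ (M.peel a '' U) = M.lnAbs a + M.logμ U := by
  rw [M.logμ_peel a hU, lnAbs, neg_mul]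

/-- `log μ̄_{v⃗}(a·O_{v⃗}) = ln|a|_p` (normalisation `log μ̄(O) = 0`) — the tensor-packet form of (3.4)
`log μ̄_{F_{0,v}}(a_v O_v) = ln|a_v|_p`. [cite: DupuyHilado2025, §3.4, §3.7] -/
theorem logμ_peel_O {p j : ℕ} {e : Fin (j + 1) → placesOver F p} (a : M.Λ p (e (Fin.last j))) :
    M.logμ (M.peel a '' M.O p j e) = M.lnAbs a := by
  rw [M.logμ_peel_eq a (M.O_adm p j e), M.logμ_O, add_zero]

/-! ## Random measurable sets and the log-measures `ln ν̄` (Def. 3.5.1, 3.6.3) -/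

/-- A random measurable set of `𝕃` (componentwise: one subset of each summand `X_{v⃗}`, for every `p`,
`j`, `v⃗` — Rmk. 3.5.2's conflation of `(U_s)_s` with `Π_s U_s`). [cite: DupuyHilado2025, Def. 3.5.1] -/
abbrev Region : Type _ := (p : ℕ) → (j : ℕ) → (e : Fin (j + 1) → placesOver F p) → Set (M.X p j e)

/-- A region is admissible if all its components are. [cite: DupuyHilado2025, Def. 3.5.1] -/
def RegionAdm (B : M.Region) : Prop := ∀ p j e, M.adm (B p j e)

/-- `ln ν̄_{𝔸^{⊗ j+1}_{V̲,p}}(B) = 𝔼(log μ̄_{v⃗}(B_{v⃗}) : v⃗ ∈ V(F₀)_p^{j+1})` (§3.6), written out as the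
weighted sum `Σ_{v⃗} log μ̄_{v⃗}(B_{v⃗})·Π_k Pr(v_k)` (so that the definition is total in `p`; for a prime
`p` it IS the expectation over `tupleWeights`, `lnνTensorPower_eq_expect`).
[cite: DupuyHilado2025, §3.6, Def. 3.6.3] -/
def lnνTensorPower (p : ℕ) (j : ℕ) (B : M.Region) : ℝ :=
  ∑ e : Fin (j + 1) → placesOver F p, M.logμ (B p j e) * ∏ k, weight F (e k).1

/-- For a prime `p`: `ln ν̄_{𝔸^{⊗ j+1}_{V̲,p}}(B) = 𝔼_{tupleWeights}(log μ̄_{v⃗}(B_{v⃗}))`.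
[cite: DupuyHilado2025, §3.6] -/
theorem lnνTensorPower_eq_expect (p : ℕ) [Fact p.Prime] (j : ℕ) (B : M.Region) :
    M.lnνTensorPower p j B = (tupleWeights F p j).expect (fun e => M.logμ (B p j e)) := rfl

/-- `ln ν̄_{𝕃_p}(B) = 𝔼(ln ν̄_{𝔸^{⊗ j+1}_{V̲,p}}(B_p^{(j+1)}) | 1 ≤ j ≤ ℓ⋇) = (1/ℓ⋇) Σ_{j=1}^{ℓ⋇} …` (Def. 3.6.3;
index `i : Fin ℓ⋇` is `j = i+1`). [cite: DupuyHilado2025, Def. 3.6.3] -/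
def lnνLp (lstar : ℕ) (p : ℕ) (B : M.Region) : ℝ :=
  (1 / (lstar : ℝ)) * ∑ i : Fin lstar, M.lnνTensorPower p ((i : ℕ) + 1) B

/-- `ln ν̄_{𝕃_p}` is the expectation over the procession index space. [cite: DupuyHilado2025, Def. 3.6.3] -/
theorem lnνLp_eq_expect (lstar : ℕ) [NeZero lstar] (p : ℕ) (B : M.Region) :
    M.lnνLp lstar p B =
      (processionWeights lstar).expect (fun i => M.lnνTensorPower p ((i : ℕ) + 1) B) := by
  rw [processionWeights_expect, lnνLp]

/-- `ln ν̄_𝕃(B) = Σ_p ln ν̄_{𝕃_p}(B_p)` summed over a finite set `T` of primes (Def. 3.6.3; see the module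
docstring's `TODO(general form)`). [cite: DupuyHilado2025, Def. 3.6.3] -/
def lnνL (lstar : ℕ) (T : Finset ℕ) (B : M.Region) : ℝ := ∑ p ∈ T, M.lnνLp lstar p B

/-- `ln ν̄_{𝔸^{⊗ j+1}}` is monotone on admissible regions. [cite: DupuyHilado2025, §3.6] -/
theorem lnνTensorPower_mono (p : ℕ) (j : ℕ) {A B : M.Region} (hA : M.RegionAdm A)
    (hB : M.RegionAdm B) (hAB : ∀ p j e, A p j e ⊆ B p j e) :
    M.lnνTensorPower p j A ≤ M.lnνTensorPower p j B :=
  Finset.sum_le_sum fun e _ => mul_le_mul_of_nonneg_right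
    (M.logμ_mono (hA p j e) (hB p j e) (hAB p j e))
    (Finset.prod_nonneg fun k _ => weight_nonneg F (e k).1)

/-- `ln ν̄_{𝕃_p}` is monotone on admissible regions. [cite: DupuyHilado2025, Def. 3.6.3] -/
theorem lnνLp_mono (lstar : ℕ) (p : ℕ) {A B : M.Region}
    (hA : M.RegionAdm A) (hB : M.RegionAdm B) (hAB : ∀ p j e, A p j e ⊆ B p j e) :
    M.lnνLp lstar p A ≤ M.lnνLp lstar p B :=
  mul_le_mul_of_nonneg_left (Finset.sum_le_sum fun _ _ => M.lnνTensorPower_mono p _ hA hB hAB)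
    (by positivity)

/-- `ln ν̄_𝕃` is monotone on admissible regions. [cite: DupuyHilado2025, Def. 3.6.3] -/
theorem lnνL_mono (lstar : ℕ) (T : Finset ℕ) {A B : M.Region}
    (hA : M.RegionAdm A) (hB : M.RegionAdm B) (hAB : ∀ p j e, A p j e ⊆ B p j e) :
    M.lnνL lstar T A ≤ M.lnνL lstar T B :=
  Finset.sum_le_sum fun p _ => M.lnνLp_mono lstar p hA hB hAB

/-- The integral structure `O_𝕃 = (O_{v⃗})` as a region has `ln ν̄ = 0` at every level.
[cite: DupuyHilado2025, §3.6] -/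
theorem lnνTensorPower_O (p : ℕ) (j : ℕ) : M.lnνTensorPower p j M.O = 0 := by
  simp [lnνTensorPower, M.logμ_O]

/-! ## The regions `O_𝕃(−div(t))` of an lgp-idele (§3.9) -/

/-- An **lgp-idele**: for each procession index `j = i+1` (`i : Fin ℓ⋇`) and each place `v | p`, a
local scalar `t_{j,v} ∈ Λ_v` — the choice "`a = (a_{v̲}) ∈ 𝔸_{V̲}` such that `D = div(a)`" of §3.9,
one for each component `D_j` of an lgp-divisor. [cite: DupuyHilado2025, §3.9] -/
abbrev LgpIdele (lstar : ℕ) : Type _ := Fin lstar → (p : ℕ) → (v : placesOver F p) → M.Λ p v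

/-- The divisor of an lgp-idele over a finite set of primes `T`: `div_T(t)_j := Σ_{p∈T} Σ_{v|p}
ord_v(t_{j,v})[v]` (real coefficients). [cite: DupuyHilado2025, §2.5.4, §3.9] -/
def LgpIdele.div {lstar : ℕ} (t : M.LgpIdele lstar) (T : Finset ℕ) : LgpDivisor F lstar :=
  fun i => ∑ p ∈ T, ∑ v : placesOver F p, FinDivisor.of v.1 (M.ordv (t i p v))

/-- **The region `O_𝕃(−div(t))`** (§3.9): in the summand `X_{(v_0,…,v_j)}` of `𝔸^{⊗ j+1}_{V̲,p}`,
`j = i+1 ∈ {1,…,ℓ⋇}`, it is `t_{j,v_j} · O_{v⃗}` (peel action of the scalar at the LAST index); in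
tensor powers not occurring in `𝕃_p = ⊕_{j=1}^{ℓ⋇} 𝔸^{⊗ j+1}` (i.e. `j = 0` or `j > ℓ⋇`) we put `O_{v⃗}`
(log-measure `0`; these components are never averaged). [cite: DupuyHilado2025, §3.9] -/
def region {lstar : ℕ} (t : M.LgpIdele lstar) : M.Region := fun p j e =>
  if h : 0 < j ∧ j - 1 < lstar then M.peel (t ⟨j - 1, h.2⟩ p (e (Fin.last j))) '' M.O p j e
  else M.O p j e

/-- The region `O_𝕃(−div(t))` is admissible. [cite: DupuyHilado2025, §3.9] -/
theorem region_adm {lstar : ℕ} (t : M.LgpIdele lstar) : M.RegionAdm (M.region t) := by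
  intro p j e
  unfold region
  split_ifs with h
  · exact M.peel_adm _ (M.O_adm p j e)
  · exact M.O_adm p j e

/-- The component of `O_𝕃(−div(t))` in `𝔸^{⊗ (i+1)+1}`, `i : Fin ℓ⋇`, unfolded.
[cite: DupuyHilado2025, §3.9] -/
theorem region_succ {lstar : ℕ} (t : M.LgpIdele lstar) (i : Fin lstar) (p : ℕ)
    (e : Fin ((i : ℕ) + 1 + 1) → placesOver F p) :
    M.region t p ((i : ℕ) + 1) e = M.peel (t i p (e (Fin.last _))) '' M.O p _ e := by
  have h : 0 < (i : ℕ) + 1 ∧ (i : ℕ) + 1 - 1 < lstar := ⟨Nat.succ_pos _, by have := i.2; omega⟩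
  simp only [region, dif_pos h]
  rfl

/-! ## Theorem 3.10.1: degree/volume conversion -/

/-- **Thm. 3.10.1 (ii), tensor-power case** (per prime `p` and per `j = i+1`):
`ln ν̄_{𝔸^{⊗ j+1}_{V̲,p}}(O(−div(t))) = 𝔼(ln|t_{j,v}|_p : v ∈ V(F)_p) = −deĝ̲(Σ_{v|p} ord_v(t_{j,v})[v])` —
"The second line follows from (E:peel-mult), … the last equality follows exactly the same reasoning as
… for `r = 1`". [cite: DupuyHilado2025, Thm. 3.10.1] -/
theorem lnνTensorPower_region {lstar : ℕ} (t : M.LgpIdele lstar) (p : ℕ) [Fact p.Prime]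
    (i : Fin lstar) :
    M.lnνTensorPower p ((i : ℕ) + 1) (M.region t) =
      -FinDivisor.ndeg F (∑ v : placesOver F p, FinDivisor.of v.1 (M.ordv (t i p v))) := by
  -- unfold the region in degree `j = i+1` and apply (3.7)/(3.4) summand by summand
  have h1 : (tupleWeights F p ((i : ℕ) + 1)).expect (fun e => M.logμ (M.region t p ((i : ℕ) + 1) e)) =
      (tupleWeights F p ((i : ℕ) + 1)).expect (fun e => M.lnAbs (t i p (e (Fin.last _)))) := by
    refine congrArg _ (funext fun e => ?_)
    rw [M.region_succ t i p e, M.logμ_peel_O]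
  -- the integrand depends on the last coordinate only: average over places instead of tuples;
  -- then (3.4) and the cancellation `Pr(v)/n_v = 1/[F:ℚ]`
  rw [M.lnνTensorPower_eq_expect, h1,
    tupleWeights_expect_coord F p ((i : ℕ) + 1) (Fin.last _) (fun v => M.lnAbs (t i p v))]
  exact expect_neg_deg_div_localDegree' F p (fun v => M.ordv (t i p v))

/-- **Thm. 3.10.1 (iii) at `p`**: `ln ν̄_{𝕃_p}(O_𝕃(−div(t))) = −(1/ℓ⋇) Σ_j deĝ̲(div(t)_{j,p})`, the
procession average of the tensor-power case. [cite: DupuyHilado2025, Thm. 3.10.1] -/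
theorem lnνLp_region {lstar : ℕ} (t : M.LgpIdele lstar) (p : ℕ) [Fact p.Prime] :
    M.lnνLp lstar p (M.region t) = -(1 / (lstar : ℝ)) *
      ∑ i : Fin lstar, FinDivisor.ndeg F
        (∑ v : placesOver F p, FinDivisor.of v.1 (M.ordv (t i p v))) := by
  unfold lnνLp
  simp only [M.lnνTensorPower_region t p, Finset.sum_neg_distrib]
  ring

/-- **Thm. 3.10.1 (iii) (Conversion for lgp Divisors)**: for an lgp-idele `t` and a finite set of
primes `T`, `ln ν̄_𝕃(O_𝕃(−div_T(t))) = −deĝ̲_lgp(div_T(t))` — "`−deĝ̲_{lgp,F₀}(D) = ln ν̄_𝕃(O_𝕃(−D))`"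
for `D = div_T(t)`. PROVED from the interface axioms (3.4)/(3.7) and the normalisation
`log μ̄(O) = 0` by the averaging identities of `FakeAdeleIndex`. [cite: DupuyHilado2025, Thm. 3.10.1] -/
theorem lnνL_region_eq_neg_ndegLgp {lstar : ℕ} (t : M.LgpIdele lstar)
    (T : Finset ℕ) (hT : ∀ p ∈ T, p.Prime) :
    M.lnνL lstar T (M.region t) = -LgpDivisor.ndegLgp (LgpIdele.div M t T) := by
  unfold lnνL LgpDivisor.ndegLgp LgpIdele.div
  have h : ∀ p ∈ T, M.lnνLp lstar p (M.region t) = -(1 / (lstar : ℝ)) *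
      ∑ i : Fin lstar, FinDivisor.ndeg F
        (∑ v : placesOver F p, FinDivisor.of v.1 (M.ordv (t i p v))) := by
    intro p hp
    haveI : Fact p.Prime := ⟨hT p hp⟩
    exact M.lnνLp_region t p
  rw [Finset.sum_congr rfl h]
  simp only [map_sum]
  rw [Finset.sum_comm, ← Finset.mul_sum, neg_mul]

end PacketModel

end Literature.IUT.LogVolume

end
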